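import Mathlib.Geometry.Manifold.Instances.Sphere
import Mathlib.Analysis.SpecialFunctions.Complex.Circle
import Mathlib.Data.ENat.Lattice
import Literature.Topology.FourManifolds.Morse
import HarnessLib

/-!
# Circle-valued Morse maps (definition request `defn-IsCircleMorse`, route SmoothPoincare4/CircularKirby)

Circle-valued Morse theory (Novikov 1981; Pajitnov, *Circle-valued Morse theory*, de Gruyter 2006)
studies smooth maps `f : M → S¹` all of whose critical points are nondegenerate. This file
generalises the tree's real-valued `Morse.lean` (`IsMCriticalPt`, `mhessian`, `IsMorse`,
`morseIndex`, …) to maps into Mathlib's unit circle `Circle ⊂ ℂ` (an analytic Lie group charted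
over `EuclideanSpace ℝ (Fin 1)`, model `𝓡 1`, `Mathlib/Geometry/Manifold/Instances/Sphere.lean`):

* `circleHeight f x : M → ℝ`, `y ↦ Im (f y / f x)` — the **local height** of `f` at `x`: near `x`
  it is `sin ∘ θ` for any local angle lift `θ` of `f` with `θ x = 0` (`circleHeight_exp_comp`:
  for `f = Circle.exp ∘ g` it is `y ↦ sin (g y - g x)` exactly), so it has the same critical points
  near `x` and, at a critical point `x`, the same Hessian as `θ` (`Hess (sin ∘ θ) = cos θ · Hess θ
  - sin θ · dθ ⊗ dθ = Hess θ` at `θ = 0`, `dθ = 0`). This avoids choosing lifts.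
* `IsCircleCriticalPt I f x` (`mfderiv I (𝓡 1) f x = 0`), `circleCriticalSet`, `circleHessian`
  (`= mhessian` of the local height), `IsCircleMorse I f` (smooth + nondegenerate Hessian at every
  critical point), `circleMorseIndex` (`sigNeg`, via `morseIndex` of the local height),
  `circleCriticalSetOfIndex`.
* `IsPrimitive f` — the pull-back `{(p, t) | f p = e^{it}}` of the universal cover
  `Circle.exp : ℝ → S¹` along `f` is connected (for connected `M`: `f_* : π₁ M → π₁ S¹ = ℤ` is onto,
  i.e. the class `[f] ∈ H¹(M; ℤ)` is indivisible and non-zero).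
* `circleMorseNumber I M : ℕ∞` — the **Morse–Novikov number** in the variant requested by the
  route: the least number of critical points of a primitive circle-valued Morse map on `M`
  (`sInf` over `encard`s in `ℕ∞`; `⊤` if there is no such map). Pajitnov's `𝓜𝓝(M, ξ)` minimises
  over Morse maps in a fixed class `ξ`; Endo–Pajitnov [EndoPajitnov2017, Def. 1.2] minimise over
  regular Morse maps on a 2-knot complement; here the minimum is over all primitive classes.
* Named fact `IsCircleMorse.finite_circleCriticalSet` — on a compact manifold a circle-valued Morse
  map has finitely many critical points (nondegenerate critical points are isolated: Milnor 1963,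
  Cor. 2.3, applied to the local heights).

Not here (wanted by the route, no verified printed source at hand): elimination of critical points
of index `0` and `n` for primitive maps on closed connected `M` (Pajitnov–Rudolph–Weber, Lemma 3.2;
[EndoPajitnov2017, Prop. 1.3] is the 2-knot-complement version), and the count
`Σ (-1)^i #Crit_i = χ(M)` (Poincaré–Hopf for the gradient of `f`).

## References

* A. Pajitnov, *Circle-valued Morse theory*, de Gruyter Studies in Math. 32 (2006). [Pajitnov2006]
* H. Endo, A. Pajitnov, *On the Morse–Novikov number for 2-knots*, Osaka J. Math. 54 (2017)
  723–734 (arXiv:1502.06352), §1.2, Def. 1.2, Prop. 1.3 (held text `paper:arxiv-1502.06352`,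
  chunk 3). [EndoPajitnov2017]
* J. Milnor, *Morse theory*, Ann. of Math. Studies 51 (1963), §2, Cor. 2.3. [Milnor1963]
-/

open scoped Manifold ContDiff
open Set Function

noncomputable section

namespace Literature.Topology.FourManifolds

section Height

variable {M : Type*}

/-- The **local height** of `f : M → Circle` at `x`: `y ↦ Im (f y / f x)` (the sine of the angle
from `f x` to `f y`). It vanishes at `x`, and near `x` equals `sin ∘ θ` for every local angle lift
`θ` of `f` with `θ x = 0`; at a critical point its Hessian is the Hessian of `θ`.
[cite: EndoPajitnov2017, §1.2 (Morse maps to S¹, terminology of Pajitnov 2006)] -/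
def circleHeight (f : M → Circle) (x : M) : M → ℝ :=
  fun y => ((f y / f x : Circle) : ℂ).im

/-- The local height vanishes at the base point. [folklore] -/
@[simp] theorem circleHeight_self (f : M → Circle) (x : M) : circleHeight f x x = 0 := by
  simp [circleHeight]

/-- For a map with a global lift, `f = e^{ig}`, the local height at `x` is `y ↦ sin (g y - g x)`.
[folklore] -/
theorem circleHeight_exp_comp (g : M → ℝ) (x y : M) :
    circleHeight (fun z => Circle.exp (g z)) x y = Real.sin (g y - g x) := by
  simp only [circleHeight, Circle.coe_div, Circle.coe_exp]
  rw [← Complex.exp_sub, show (g y : ℂ) * Complex.I - (g x : ℂ) * Complex.I =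
    ((g y - g x : ℝ) : ℂ) * Complex.I by push_cast; ring, Complex.exp_ofReal_mul_I_im]

end Height

section General

variable {E H : Type*} [NormedAddCommGroup E] [NormedSpace ℝ E] [TopologicalSpace H]
  (I : ModelWithCorners ℝ E H) {M : Type*} [TopologicalSpace M] [ChartedSpace H M]

/-- `x` is a *critical point* of `f : M → Circle`: `mfderiv I (𝓡 1) f x = 0` (junk-true where `f`
is not differentiable, as for `IsMCriticalPt`). [cite: EndoPajitnov2017, §1.2 (Morse maps to S¹)] -/
def IsCircleCriticalPt (f : M → Circle) (x : M) : Prop :=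
  mfderiv I (𝓡 1) f x = 0

/-- The critical set of `f : M → Circle`. [cite: EndoPajitnov2017, §1.2 (Morse maps to S¹)] -/
def circleCriticalSet (f : M → Circle) : Set M :=
  {x | IsCircleCriticalPt I f x}

variable {I} in
/-- Unfolding lemma for `circleCriticalSet`. [folklore] -/
@[simp] theorem mem_circleCriticalSet {f : M → Circle} {x : M} :
    x ∈ circleCriticalSet I f ↔ IsCircleCriticalPt I f x :=
  Iff.rfl

/-- A constant map is critical everywhere. [folklore] -/
theorem isCircleCriticalPt_const (c : Circle) (x : M) : IsCircleCriticalPt I (fun _ : M => c) x :=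
  mfderiv_const

/-- The **Hessian** of `f : M → Circle` at `x`: the Hessian `mhessian` (second derivative in the
preferred extended chart) of the local height `circleHeight f x` at `x`. Chart-dependent in
general; at a critical point its congruence class (nondegeneracy, `sigNeg`) is that of any local
angle lift. [cite: EndoPajitnov2017, §1.2 (Morse maps to S¹)] -/
def circleHessian (f : M → Circle) (x : M) : LinearMap.BilinForm ℝ E :=
  mhessian I (circleHeight f x) x

/-- `f : M → Circle` is a **circle-valued Morse map**: smooth (`C^∞` into the Lie group `Circle`)
and every critical point is nondegenerate. [cite: EndoPajitnov2017, §1.2 (Morse maps to S¹, terminology of Pajitnov 2006)] -/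
def IsCircleMorse (f : M → Circle) : Prop :=
  ContMDiff I (𝓡 1) ∞ f ∧ ∀ x, IsCircleCriticalPt I f x → (circleHessian I f x).Nondegenerate

variable {I} in
/-- A circle-valued Morse map is smooth. [folklore] -/
theorem IsCircleMorse.contMDiff {f : M → Circle} (hf : IsCircleMorse I f) :
    ContMDiff I (𝓡 1) ∞ f :=
  hf.1

variable {I} in
/-- Its Hessian at a critical point is nondegenerate. [folklore] -/
theorem IsCircleMorse.nondegenerate {f : M → Circle} (hf : IsCircleMorse I f) {x : M}
    (hx : IsCircleCriticalPt I f x) : (circleHessian I f x).Nondegenerate :=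
  hf.2 x hx

/-- The **index** of `f : M → Circle` at `x`: `sigNeg` of the Hessian, i.e. `morseIndex` of the
local height. [cite: EndoPajitnov2017, §1.2 (m_p(f), critical points of index p)] -/
def circleMorseIndex (f : M → Circle) (x : M) : ℕ :=
  morseIndex I (circleHeight f x) x

/-- `circleMorseIndex` is `sigNeg` of `circleHessian`. [folklore] -/
theorem circleMorseIndex_eq (f : M → Circle) (x : M) :
    circleMorseIndex I f x = sigNeg (circleHessian I f x).toQuadraticMap :=
  rfl

/-- The index is at most the dimension of the model space. [folklore] -/
theorem circleMorseIndex_le_finrank (f : M → Circle) (x : M) :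
    circleMorseIndex I f x ≤ Module.finrank ℝ E :=
  morseIndex_le_finrank I _ x

/-- Critical points of index `k` (count them with `Set.ncard` / `Set.encard`).
[cite: EndoPajitnov2017, §1.2 (m_p(f))] -/
def circleCriticalSetOfIndex (f : M → Circle) (k : ℕ) : Set M :=
  {x | IsCircleCriticalPt I f x ∧ circleMorseIndex I f x = k}

variable {I} in
/-- Unfolding lemma. [folklore] -/
@[simp] theorem mem_circleCriticalSetOfIndex {f : M → Circle} {k : ℕ} {x : M} :
    x ∈ circleCriticalSetOfIndex I f k ↔ IsCircleCriticalPt I f x ∧ circleMorseIndex I f x = k :=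
  Iff.rfl

/-- Critical points of index `k` are critical points. [folklore] -/
theorem circleCriticalSetOfIndex_subset (f : M → Circle) (k : ℕ) :
    circleCriticalSetOfIndex I f k ⊆ circleCriticalSet I f :=
  fun _ hx => hx.1

/-- The critical set is the union over the indices. [folklore] -/
theorem iUnion_circleCriticalSetOfIndex (f : M → Circle) :
    ⋃ k, circleCriticalSetOfIndex I f k = circleCriticalSet I f := by
  ext x
  simp only [mem_iUnion, mem_circleCriticalSetOfIndex, mem_circleCriticalSet, exists_and_left,
    exists_eq', and_true]

/-- `f : M → Circle` is **primitive**: the pull-back `{(p, t) | f p = e^{it}}` of the universal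
covering `Circle.exp : ℝ → S¹` along `f` is connected — for connected `M` this says
`f_* : π₁(M) → π₁(S¹) = ℤ` is surjective (the class of `f` in `H¹(M; ℤ) = [M, S¹]` is non-zero and
indivisible), so the infinite cyclic covering of `f` is connected. [folklore] -/
def IsPrimitive (f : M → Circle) : Prop :=
  IsConnected {p : M × ℝ | f p.1 = Circle.exp p.2}

variable (M) in
/-- The **Morse–Novikov number** of `M` in the variant used by route SmoothPoincare4/CircularKirby:
the least number of critical points of a *primitive* circle-valued Morse map `M → S¹`, in `ℕ∞`
(`sInf` of the `encard`s of the critical sets; `⊤` if `M` has no primitive circle-valued Morse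
map, e.g. when `H¹(M; ℤ) = 0`). Pajitnov's `𝓜𝓝(M, ξ)` fixes the class `ξ`; Endo–Pajitnov's
`𝓜𝓝(K)` minimises over regular Morse maps on the 2-knot complement `S⁴ ∖ K`.
[cite: EndoPajitnov2017, Def. 1.2 (variant: closed M, primitive classes)] -/
def circleMorseNumber : ℕ∞ :=
  sInf {k : ℕ∞ | ∃ f : M → Circle, IsCircleMorse I f ∧ IsPrimitive f ∧
    (circleCriticalSet I f).encard = k}

variable {I} in
/-- A primitive circle-valued Morse map bounds the Morse–Novikov number by its number of critical
points. [cite: EndoPajitnov2017, Def. 1.2] -/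
theorem circleMorseNumber_le {f : M → Circle} (hf : IsCircleMorse I f) (hp : IsPrimitive f) :
    circleMorseNumber I M ≤ (circleCriticalSet I f).encard :=
  sInf_le ⟨f, hf, hp, rfl⟩

variable {I} in
/-- **Finiteness of the critical set** (named fact): a circle-valued Morse map on a compact manifold
has finitely many critical points — nondegenerate critical points are isolated (Milnor 1963,
Cor. 2.3, applied to the local heights `circleHeight f x`, which near `x` have the same critical
points as `f`). [cite: Milnor1963, Cor. 2.3 (via local heights)] -/
def IsCircleMorse.finite_circleCriticalSet : Prop :=
  ∀ [IsManifold I ∞ M] [CompactSpace M] {f : M → Circle}, IsCircleMorse I f →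
    (circleCriticalSet I f).Finite

end General

/-! ### Basic instances on the circle itself -/

section CircleInstances

/-- The pull-back of the universal cover along the identity of `S¹` is the connected curve
`{(e^{it}, t)}`: the identity `S¹ → S¹` is primitive. [folklore] -/
theorem isPrimitive_id : IsPrimitive (fun z : Circle => z) := by
  have : {p : Circle × ℝ | (fun z : Circle => z) p.1 = Circle.exp p.2} =
      Set.range (fun t : ℝ => (Circle.exp t, t)) := by
    ext ⟨z, t⟩
    simp only [mem_setOf_eq, mem_range, Prod.mk.injEq]
    constructor
    · intro h; exact ⟨t, h.symm, rfl⟩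
    · rintro ⟨s, hs, rfl⟩; exact hs.symm
  rw [IsPrimitive, this]
  exact isConnected_range (Circle.exp.continuous.prodMk continuous_id)

/-- The identity of `S¹` has no critical points. [folklore] -/
theorem circleCriticalSet_id : circleCriticalSet (𝓡 1) (fun z : Circle => z) = ∅ := by
  ext x
  simp only [mem_circleCriticalSet, IsCircleCriticalPt, mem_empty_iff_false, iff_false]
  have hid : mfderiv (𝓡 1) (𝓡 1) (fun z : Circle => z) x =
      ContinuousLinearMap.id ℝ (TangentSpace (𝓡 1) x) := mfderiv_id
  rw [hid]
  intro h
  let v : EuclideanSpace ℝ (Fin 1) := EuclideanSpace.single 0 1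
  have hv : (ContinuousLinearMap.id ℝ (TangentSpace (𝓡 1) x)) v =
      (0 : TangentSpace (𝓡 1) x →L[ℝ] TangentSpace (𝓡 1) x) v := by rw [h]
  have hv' : v = 0 := by
    have h1 : @Eq (TangentSpace (𝓡 1) x) v 0 := by simpa using hv
    exact h1
  have hn : ‖v‖ = 1 := by simp [v]
  rw [hv', norm_zero] at hn
  exact zero_ne_one hn

/-- The identity of `S¹` is a (critical-point-free) circle-valued Morse map. [folklore] -/
theorem isCircleMorse_id : IsCircleMorse (𝓡 1) (fun z : Circle => z) := by
  refine ⟨contMDiff_id, fun x hx => ?_⟩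
  have : x ∈ circleCriticalSet (𝓡 1) (fun z : Circle => z) := hx
  rw [circleCriticalSet_id] at this
  exact this.elim

/-- Hence the Morse–Novikov number of the circle (in the primitive variant) is `0`. [folklore] -/
theorem circleMorseNumber_circle : circleMorseNumber (𝓡 1) Circle = 0 := by
  have h := circleMorseNumber_le (I := 𝓡 1) isCircleMorse_id isPrimitive_id
  rw [circleCriticalSet_id, Set.encard_empty] at h
  exact nonpos_iff_eq_zero.mp h

end CircleInstances

end Literature.Topology.FourManifolds
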